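import Literature.RepresentationTheory.Semisimple.BrauerNesbitt
import Literature.NumberTheory.GaloisRepresentations.ContinuousRep
import Summits.Langlands.Langlands.Theorems.ResiduallyYoshidaLifting.Negative.ShLagrangianDuality
import Mathlib.LinearAlgebra.Matrix.ToLin
import Mathlib.LinearAlgebra.Matrix.GeneralLinearGroup.Defs
import Mathlib.LinearAlgebra.Charpoly.ToMatrix
import Mathlib.RepresentationTheory.Irreducible
import HarnessLib

/-!
# Route `PhantomRMYoshida`, crux `ResiduallyYoshidaLifting` (stmt-Langlands-13639), line `sector-klingen-split`:
# stub T7 `stub_twistOfDualCharpoly` — the Brauer–Nesbitt step (twisted-dual characteristic polynomials force a twist pair)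

The registered sub-goal `stub_twistOfDualCharpoly` of the checked skeleton `Lines/sector_klingen_split.lean` (rev 7, lead
c4-0): for a field `k` (any characteristic), a group `Γ`, homomorphisms `σ, σ' : Γ → GL₂(k)` irreducible on `k²` and a
character `χ : Γ → kˣ` with `det(X - σ' g) = det(X - χ(g) · (σ g)ᵀ⁻¹)` for all `g`, there is `A ∈ GL₂(k)` with
`A σ(x) A⁻¹ ∈ k · σ'(x)` for every `x` — the skeleton's pointwise-scalar TWIST-PAIR form `∃ A, ∀ x, ∃ c, A σ x A⁻¹ = c • σ' x`.

Proof.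
* On `2 × 2` matrices `J₂ A J₂⁻¹ = adj(A)ᵀ` (`J₂_mul_mul_J₂inv_eq_adjugate_transpose`, Theorems-side Lagrangian duality
  file), so `χ · Aᵀ⁻¹ = χ · A⁻¹ᵀ = (χ / det A) · adj(A)ᵀ = J₂ ((χ / det A) · A) J₂⁻¹` and, the characteristic polynomial
  being a conjugation invariant, `det(X - χ · Aᵀ⁻¹) = det(X - (χ / det A) · A)` (`charpoly_smul_transpose_inv`).
* The scalar twist `σt := (χ / det σ) · σ` is a homomorphism `Γ → GL₂(k)` (`exists_twist_hom`: scalars are central) whose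
  standard representation has the same stable subspaces as that of `σ`, hence is irreducible
  (`isIrreducible_of_val_eq_smul`), hence semisimple; `σ'` is irreducible, hence semisimple; and by the first point
  `det(X - σ' g) = det(X - σt g)` for all `g`.
* The Brauer–Nesbitt theorem over an arbitrary field
  (`Literature.RepresentationTheory.Semisimple.Representation.nonempty_equiv_of_charpoly_eq`, Bourbaki A VIII § 20 n° 6
  Thm 2 Cor 1) in matrix form (`exists_conj_of_charpoly_eq`, re-derived here after the private lemma of
  `…BlockSumConj.lean`) gives `H ∈ GL₂(k)` with `σ' = H σt H⁻¹ = (χ / det σ) · H σ H⁻¹`, i.e.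
  `H σ(x) H⁻¹ = (χ(x) / det σ(x))⁻¹ · σ'(x)`.

References: N. Bourbaki, *Algèbre* VIII (2012), § 20 n° 6, Thm 2, Cor 1 [BourbakiAlgebreVIII2012].  No new definitions;
helper lemmas are private.
-/

noncomputable section

-- `Summit.Langlands.Langlands.…` (summit = sub-problem name, D-0017 layout) trips `dupNamespace` on every decl;
-- project-wide option (lakefile `weak.linter.dupNamespace = false`).
set_option linter.dupNamespace false
set_option autoImplicit false

open scoped MatrixGroups Matrix

namespace Summit.Langlands.Langlands.Cruxes.ResiduallyYoshidaLifting.SectorKlingenSplit.Fibre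

open Literature.NumberTheory.GaloisRepresentations
open Literature.RepresentationTheory.Semisimple
open Summit.Langlands.Langlands.Theorems.ResiduallyYoshidaLifting.Negative

variable {k : Type*} [Field k] {Γ : Type*} [Group Γ]

/-! ### The matrix form of the Brauer–Nesbitt theorem (after the private lemma of `…BlockSumConj.lean`) -/

/-- The characteristic polynomial of `g` in the standard representation of `Γ` on `kⁿ` through `ψ : Γ → GL_n(k)`
(`v ↦ ψ(g) *ᵥ v`) is the characteristic polynomial of the matrix `ψ(g)`. [folklore] -/
private theorem charpoly_rep_eq {n : ℕ} (ψ : Γ →* GL (Fin n) k) (g : Γ) :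
    (((glStdRepresentation (Fin n) k).comp ψ) g).charpoly = (ψ g).val.charpoly := by
  have hRlin : (((glStdRepresentation (Fin n) k).comp ψ) g : (Fin n → k) →ₗ[k] (Fin n → k)) =
      Matrix.toLin' (ψ g).val :=
    LinearMap.ext fun v ↦ by rw [Matrix.toLin'_apply]; rfl
  rw [hRlin, Matrix.charpoly_toLin']

/-- The standard representation on `kⁿ` through `ψ : Γ → GL_n(k)`, as a linear map, is `Matrix.toLin'` of the matrix
`ψ(g)`; hence its matrix in the standard basis is `ψ(g)`. [folklore] -/
private theorem toMatrix'_rep_eq {n : ℕ} (ψ : Γ →* GL (Fin n) k) (g : Γ) :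
    LinearMap.toMatrix' (((glStdRepresentation (Fin n) k).comp ψ) g : (Fin n → k) →ₗ[k] (Fin n → k)) =
      (ψ g).val := by
  have hRlin : (((glStdRepresentation (Fin n) k).comp ψ) g : (Fin n → k) →ₗ[k] (Fin n → k)) =
      Matrix.toLin' (ψ g).val :=
    LinearMap.ext fun v ↦ by rw [Matrix.toLin'_apply]; rfl
  rw [hRlin, LinearMap.toMatrix'_toLin']

/-- An irreducible representation is semisimple (a simple bounded lattice is complemented). [folklore] -/
private theorem isSemisimple_of_isIrreducible {V : Type*} [AddCommGroup V] [Module k V]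
    (ρ : Representation k Γ V) (h : ρ.IsIrreducible) : ρ.IsSemisimpleRepresentation := by
  haveI : IsSimpleOrder (Subrepresentation ρ) := h
  exact (inferInstance : ComplementedLattice (Subrepresentation ρ))

/-- **Conjugacy of semisimple matrix representations with equal characteristic polynomials** (Brauer–Nesbitt in matrix
form): if `ψ₁, ψ₂ : Γ → GL_n(k)` have semisimple standard representations on `kⁿ` and `det(X - ψ₁ g) = det(X - ψ₂ g)` for
all `g`, then `ψ₁ = h ψ₂ h⁻¹` for some `h ∈ GL_n(k)`.  (Re-derivation of the private lemma of `…BlockSumConj.lean` from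
`Representation.nonempty_equiv_of_charpoly_eq`.) [cite: BourbakiAlgebreVIII2012, VIII § 20 n° 6, Thm. 2, Cor. 1 (p. 378)] -/
private theorem exists_conj_of_charpoly_eq {n : ℕ} (ψ₁ ψ₂ : Γ →* GL (Fin n) k)
    (h₁ : Representation.IsSemisimpleRepresentation ((glStdRepresentation (Fin n) k).comp ψ₁))
    (h₂ : Representation.IsSemisimpleRepresentation ((glStdRepresentation (Fin n) k).comp ψ₂))
    (hcp : ∀ g, (ψ₁ g).val.charpoly = (ψ₂ g).val.charpoly) :
    ∃ h : GL (Fin n) k, ∀ g, (ψ₁ g).val = h.val * (ψ₂ g).val * (h⁻¹).val := by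
  set ρ₁ : Representation k Γ (Fin n → k) := (glStdRepresentation (Fin n) k).comp ψ₁ with hρ₁
  set ρ₂ : Representation k Γ (Fin n → k) := (glStdRepresentation (Fin n) k).comp ψ₂ with hρ₂
  haveI : ρ₁.IsSemisimpleRepresentation := h₁
  haveI : ρ₂.IsSemisimpleRepresentation := h₂
  have hcp' : ∀ g, (ρ₁ g).charpoly = (ρ₂ g).charpoly := fun g ↦ by
    rw [hρ₁, hρ₂, charpoly_rep_eq, charpoly_rep_eq, hcp g]
  obtain ⟨e⟩ := Representation.nonempty_equiv_of_charpoly_eq ρ₁ ρ₂ hcp'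
  -- the matrix `H` of `e` and the matrix `H'` of `e⁻¹`
  set E : (Fin n → k) ≃ₗ[k] (Fin n → k) := e.toLinearEquiv with hE
  set H : Matrix (Fin n) (Fin n) k := LinearMap.toMatrix' (E : (Fin n → k) →ₗ[k] (Fin n → k)) with hH
  set H' : Matrix (Fin n) (Fin n) k := LinearMap.toMatrix' (E.symm : (Fin n → k) →ₗ[k] (Fin n → k)) with hH'
  have hHH' : H * H' = 1 := by
    rw [hH, hH', ← LinearMap.toMatrix'_comp, LinearEquiv.comp_symm, LinearMap.toMatrix'_id]
  have hH'H : H' * H = 1 := by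
    rw [hH, hH', ← LinearMap.toMatrix'_comp, LinearEquiv.symm_comp, LinearMap.toMatrix'_id]
  -- the intertwining identity in matrix form
  have hint : ∀ g, H * (ψ₁ g).val = (ψ₂ g).val * H := fun g ↦ by
    have h1 : (E : (Fin n → k) →ₗ[k] (Fin n → k)) ∘ₗ (ρ₁ g) = (ρ₂ g) ∘ₗ (E : (Fin n → k) →ₗ[k] (Fin n → k)) :=
      e.toIntertwiningMap.isIntertwining' g
    have h2 := congrArg LinearMap.toMatrix' h1
    rw [LinearMap.toMatrix'_comp, LinearMap.toMatrix'_comp] at h2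
    rw [hρ₁, hρ₂, toMatrix'_rep_eq, toMatrix'_rep_eq] at h2
    exact h2
  refine ⟨⟨H', H, hH'H, hHH'⟩, fun g ↦ ?_⟩
  change (ψ₁ g).val = H' * (ψ₂ g).val * H
  calc (ψ₁ g).val
      = (H' * H) * (ψ₁ g).val := by rw [hH'H, Matrix.one_mul]
    _ = H' * (H * (ψ₁ g).val) := by rw [Matrix.mul_assoc]
    _ = H' * (ψ₂ g).val * H := by rw [hint g, Matrix.mul_assoc]

/-! ### Scalar twists of a matrix representation and the twisted dual on `GL₂` -/

/-- A scalar twist `g ↦ u(g) · σ(g)` of a homomorphism `σ : Γ → GLₙ(k)` by a character `u : Γ → kˣ` is again a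
homomorphism `Γ → GLₙ(k)` (scalar matrices are central, `Matrix.GeneralLinearGroup.scalar_commute`). [folklore] -/
private theorem exists_twist_hom {n : ℕ} (σ : Γ →* GL (Fin n) k) (u : Γ →* kˣ) :
    ∃ σt : Γ →* GL (Fin n) k, ∀ g, (σt g).val = ((u g : kˣ) : k) • (σ g).val := by
  refine ⟨MonoidHom.mk' (fun g ↦ Matrix.GeneralLinearGroup.scalar (Fin n) (u g) * σ g) fun a b ↦ ?_,
    fun g ↦ ?_⟩
  · simp only [map_mul]
    exact Commute.mul_mul_mul_comm (Matrix.GeneralLinearGroup.scalar_commute (u b) (σ a)) _ _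
  · simp only [MonoidHom.mk'_apply, Units.val_mul, Matrix.GeneralLinearGroup.coe_scalar]
    rw [Matrix.scalar_apply, ← Matrix.smul_eq_diagonal_mul]

/-- A pointwise scalar twist `τ' = c · τ` (`c(g) ≠ 0`) of an IRREDUCIBLE matrix representation `τ : Γ → GLₙ(k)` is
irreducible: the standard representations of `τ` and `τ'` on `kⁿ` have literally the same stable subspaces, so their
lattices of subrepresentations are order-isomorphic. [folklore] -/
private theorem isIrreducible_of_val_eq_smul {n : ℕ} (τ τ' : Γ →* GL (Fin n) k) (c : Γ → k)
    (hc : ∀ g, (τ' g).val = c g • (τ g).val) (hc0 : ∀ g, c g ≠ 0)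
    (hτ : Representation.IsIrreducible ((glStdRepresentation (Fin n) k).comp τ)) :
    Representation.IsIrreducible ((glStdRepresentation (Fin n) k).comp τ') := by
  haveI := hτ
  let e : Subrepresentation ((glStdRepresentation (Fin n) k).comp τ') ≃o
      Subrepresentation ((glStdRepresentation (Fin n) k).comp τ) :=
    { toFun := fun S ↦
        { toSubmodule := S.toSubmodule
          apply_mem_toSubmodule := fun g v hv ↦ by
            have h := S.apply_mem_toSubmodule g hv
            change (τ' g).val *ᵥ v ∈ S.toSubmodule at h
            change (τ g).val *ᵥ v ∈ S.toSubmodule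
            rw [hc g, Matrix.smul_mulVec] at h
            exact (S.toSubmodule.smul_mem_iff (hc0 g)).mp h }
      invFun := fun S ↦
        { toSubmodule := S.toSubmodule
          apply_mem_toSubmodule := fun g v hv ↦ by
            change (τ' g).val *ᵥ v ∈ S.toSubmodule
            rw [hc g, Matrix.smul_mulVec]
            exact S.toSubmodule.smul_mem _ (S.apply_mem_toSubmodule g hv) }
      left_inv := fun _ ↦ rfl
      right_inv := fun _ ↦ rfl
      map_rel_iff' := Iff.rfl }
  exact e.isSimpleOrder

/-- **The twisted dual on `GL₂` is a conjugate of a scalar twist**, at the level of characteristic polynomials: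
`det(X - χ · Aᵀ⁻¹) = det(X - (χ / det A) · A)` for every `2 × 2` matrix `A` — since `Aᵀ⁻¹ = A⁻¹ᵀ = det(A)⁻¹ · adj(A)ᵀ
= det(A)⁻¹ · J₂ A J₂⁻¹` (`J₂_mul_mul_J₂inv_eq_adjugate_transpose`) and the characteristic polynomial is a conjugation
invariant (`Matrix.charpoly_mul_comm`).  (Both sides are `X²` when `det A = 0`.) [folklore] -/
private theorem charpoly_smul_transpose_inv (A : Matrix (Fin 2) (Fin 2) k) (χ : k) :
    (χ • Aᵀ⁻¹).charpoly = ((χ * A.det⁻¹) • A).charpoly := by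
  have hJ : !![(0 : k), -1; 1, 0] * !![(0 : k), 1; -1, 0] = 1 := by
    ext i j; fin_cases i <;> fin_cases j <;> simp
  rw [← Matrix.transpose_nonsing_inv, Matrix.inv_def, Matrix.transpose_smul, smul_smul,
    ← J₂_mul_mul_J₂inv_eq_adjugate_transpose, ← Matrix.smul_mul, ← Matrix.mul_smul, Matrix.charpoly_mul_comm,
    ← Matrix.mul_assoc, hJ, Matrix.one_mul, Ring.inverse_eq_inv]

/-! ### The registered stub -/

/-- **Stub T7 `stub_twistOfDualCharpoly` (Brauer–Nesbitt step).**  If the irreducible `σ' : Γ → GL₂(k)` has the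
characteristic polynomials of the TWISTED DUAL `χ ⊗ σ⁻ᵀ` of the irreducible `σ : Γ → GL₂(k)`, then `(σ, σ')` is a TWIST
PAIR in the pointwise-scalar form: some `A ∈ GL₂(k)` has `A σ(x) A⁻¹ ∈ k · σ'(x)` for all `x`.  Why: on `GL₂`,
`χ · σᵀ⁻¹ = J₂ ((χ / det σ) · σ) J₂⁻¹` has the characteristic polynomials of the scalar twist `σt = (χ / det σ) · σ`, which is
irreducible with `σ`; Brauer–Nesbitt over any field (`Representation.nonempty_equiv_of_charpoly_eq`) conjugates `σ'` to `σt`,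
and `H σt H⁻¹ = (χ / det σ) · H σ H⁻¹`. [cite: BourbakiAlgebreVIII2012, VIII § 20 n° 6, Thm. 2, Cor. 1 (p. 378)] -/
theorem stub_twistOfDualCharpoly :
    ∀ (k : Type) [Field k] (Γ : Type) [Group Γ] (σ σ' : Γ →* GL (Fin 2) k) (χ : Γ →* kˣ),
      Representation.IsIrreducible ((glStdRepresentation (Fin 2) k).comp σ) →
      Representation.IsIrreducible ((glStdRepresentation (Fin 2) k).comp σ') →
      (∀ g, (σ' g).val.charpoly = (((χ g : kˣ) : k) • ((σ g).val)ᵀ⁻¹).charpoly) →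
      ∃ A : GL (Fin 2) k, ∀ x, ∃ c : k, (A * σ x * A⁻¹).val = c • (σ' x).val := by
  intro k _ Γ _ σ σ' χ hσ hσ' hcp
  -- the twisting character `u = χ / det σ`
  obtain ⟨u, hu⟩ : ∃ u : Γ →* kˣ, ∀ g, ((u g : kˣ) : k) = ((χ g : kˣ) : k) * ((σ g).val.det)⁻¹ :=
    ⟨χ / Matrix.GeneralLinearGroup.det.comp σ, fun g ↦ by
      rw [MonoidHom.div_apply, Units.val_div_eq_div_val, MonoidHom.comp_apply,
        Matrix.GeneralLinearGroup.val_det_apply, div_eq_mul_inv]⟩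
  -- the scalar twist `σt = u · σ`, irreducible hence semisimple, with the characteristic polynomials of `σ'`
  obtain ⟨σt, hσt⟩ := exists_twist_hom σ u
  have hσt_irr : Representation.IsIrreducible ((glStdRepresentation (Fin 2) k).comp σt) :=
    isIrreducible_of_val_eq_smul σ σt (fun g ↦ ((u g : kˣ) : k)) hσt (fun g ↦ (u g).ne_zero) hσ
  have hcp' : ∀ g, (σ' g).val.charpoly = (σt g).val.charpoly := fun g ↦ by
    rw [hcp g, charpoly_smul_transpose_inv, hσt g, hu g]
  -- Brauer–Nesbitt: `σ' = H σt H⁻¹`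
  obtain ⟨H, hH⟩ := exists_conj_of_charpoly_eq σ' σt (isSemisimple_of_isIrreducible _ hσ')
    (isSemisimple_of_isIrreducible _ hσt_irr) hcp'
  refine ⟨H, fun x ↦ ⟨(((u x)⁻¹ : kˣ) : k), ?_⟩⟩
  rw [Units.val_mul, Units.val_mul, hH x, hσt x, Matrix.mul_smul, Matrix.smul_mul, smul_smul, Units.inv_mul,
    one_smul]

end Summit.Langlands.Langlands.Cruxes.ResiduallyYoshidaLifting.SectorKlingenSplit.Fibre
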